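import Summits.QuantumFields.YangMills.Theorems.LangevinControlUVOSLegsFromFemtoAndGapStubCollar6
import Literature.Barriers.QuantumFields.DiscreteSubgroupFreezing

/-!
# Crux K2 `SubOnsetCeilings` (stmt-QuantumFields-23313), line `dlr-collar-subonset` — negative side, part I:
# Laplace principle for the cube kernel of the lattice Yang–Mills specification

Tools for the classical-necessity lemma (`CentredBoundaryLawClassicalNecessity.lean`), about the tree's own objects
(`ymSpecification`, `wilsonBoundaryAction`, `kerE`/`plane` currency of `DlrCollarTransfer`); nothing is posited.

* §1 `laplace_ratio`, `laplace_upper`: Laplace principle on the compact fibre `G^Λ` with product Haar measure —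
  the `e^{-βS}`-weight of `{S ≥ min + θ}` relative to the total weight is `≤ e^{-βθ/2}/p`, `p > 0` the Haar mass
  of `{S < min + θ/2}`; hence a bounded observable that is `≤ a` near the minimum has tilted mean
  `≤ a + (C + |a|) e^{-βθ/2}/p` for all `β ≥ 0`.
* §2 the Dirichlet problem on a centred cube: `wilsonBoundaryAction` is `≥ 0` and vanishes at the trivial
  configuration; the centre plaquette defect `N − plane` is one of its terms (`centre_defect_le_wilsonBoundaryAction`).
* §3 `kerE_plane_le_of_nearMin` (cap of the kernel mean of the centre field under an exterior all of whose
  near-minimisers have a bad centre) and `kerE_plane_ge_trivial` (under the trivial exterior the kernel mean of the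
  centre field is `≥ N − θ − O(e^{-βθ/2})`), via the tree's `integral_ymSpecification`.

HONEST LABEL: support lemmas; no crux is proved or refuted here; no summit.
-/

set_option autoImplicit false

noncomputable section

open scoped SchwartzMap
open MeasureTheory Filter Topology
open Literature.MathematicalPhysics.QuantumFieldTheory hiding ZdEdge
open Literature.MathematicalPhysics.QuantumLattice
open Literature.MathematicalPhysics.AQFT Literature.Probability.LatticeModels
open Summit.QuantumFields.YangMills.Cruxes.OSLegsFromFemtoAndGap.DlrCollarTransfer

namespace Summit.QuantumFields.YangMills.Theorems.SubOnsetCeilings.Negative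

variable {G : Type} [Group G] [TopologicalSpace G] [IsTopologicalGroup G] [CompactSpace G]
  [MeasurableSpace G] [BorelSpace G]

/-! ## §1 Laplace principle on the fibre `G^Λ` (product Haar, continuous action) -/

section Laplace

variable [SecondCountableTopology G] (Λ : Finset (ZdEdge 4))

/-- **Laplace ratio bound.**  For a continuous `S` on the compact fibre `G^Λ` with lower bound `m` approached
within `θ/2`, the `e^{-βS}`-weight of `{S ≥ m + θ}` is at most `e^{-βθ/2}/p` times the total weight, for all
`β ≥ 0`, with `p > 0` the Haar mass of `{S < m + θ/2}`. [folklore] -/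
theorem laplace_ratio {S : (↥Λ → G) → ℝ} (hS : Continuous S) {m θ : ℝ}
    (hm : ∀ ζ, m ≤ S ζ) (hnear : ∃ ζ, S ζ < m + θ / 2) :
    ∃ p : ℝ, 0 < p ∧ ∀ β : ℝ, 0 ≤ β →
      (0 < ∫ ζ, Real.exp (-β * S ζ) ∂(Measure.pi fun _ : ↥Λ => haarProbability G)) ∧
      ∫ ζ, Set.indicator {ζ | m + θ ≤ S ζ} (fun _ => (1 : ℝ)) ζ * Real.exp (-β * S ζ)
          ∂(Measure.pi fun _ : ↥Λ => haarProbability G) ≤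
        Real.exp (-(β * (θ / 2))) / p *
          ∫ ζ, Real.exp (-β * S ζ) ∂(Measure.pi fun _ : ↥Λ => haarProbability G) := by
  set π : Measure (↥Λ → G) := Measure.pi fun _ : ↥Λ => haarProbability G with hπ
  haveI : (haarProbability G).IsOpenPosMeasure := by rw [haarProbability]; infer_instance
  haveI hπpos : π.IsOpenPosMeasure := by rw [hπ]; infer_instance
  set O : Set (↥Λ → G) := {ζ | S ζ < m + θ / 2} with hO
  have hOopen : IsOpen O := isOpen_lt hS continuous_const
  have hπO : 0 < π O := hOopen.measure_pos π hnear
  have hπO' : π O ≠ ⊤ := measure_ne_top π O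
  have hp : 0 < (π O).toReal := ENNReal.toReal_pos hπO.ne' hπO'
  refine ⟨(π O).toReal, hp, fun β hβ => ?_⟩
  have hexpm : Measurable fun ζ : ↥Λ → G => Real.exp (-β * S ζ) :=
    (Real.continuous_exp.comp (continuous_const.mul hS)).measurable
  have hexpb : ∀ ζ, |Real.exp (-β * S ζ)| ≤ Real.exp (-β * m) := fun ζ => by
    rw [abs_of_pos (Real.exp_pos _), Real.exp_le_exp]
    have := mul_le_mul_of_nonneg_left (hm ζ) hβ
    linarith
  have hint : Integrable (fun ζ => Real.exp (-β * S ζ)) π :=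
    integrable_of_bound hexpm.aestronglyMeasurable hexpb
  have hOm : MeasurableSet O := hOopen.measurableSet
  have hBm : MeasurableSet {ζ : ↥Λ → G | m + θ ≤ S ζ} := measurableSet_le measurable_const hS.measurable
  -- lower bound on the total weight from the neighbourhood `O`
  have hZlow : Real.exp (-(β * (m + θ / 2))) * (π O).toReal ≤ ∫ ζ, Real.exp (-β * S ζ) ∂π := by
    have h1 : ∫ ζ, O.indicator (fun _ => Real.exp (-(β * (m + θ / 2)))) ζ ∂π =
        Real.exp (-(β * (m + θ / 2))) * (π O).toReal := by
      rw [integral_indicator_const (Real.exp (-(β * (m + θ / 2)))) hOm, smul_eq_mul, measureReal_def, mul_comm]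
    rw [← h1]
    refine integral_mono ((integrable_const _).indicator hOm) hint fun ζ => ?_
    by_cases hζ : ζ ∈ O
    · rw [Set.indicator_of_mem hζ, Real.exp_le_exp]
      have hζ' : S ζ < m + θ / 2 := hζ
      have := mul_le_mul_of_nonneg_left hζ'.le hβ
      linarith
    · rw [Set.indicator_of_notMem hζ]; exact (Real.exp_pos _).le
  have hZpos : 0 < ∫ ζ, Real.exp (-β * S ζ) ∂π :=
    lt_of_lt_of_le (mul_pos (Real.exp_pos _) hp) hZlow
  refine ⟨hZpos, ?_⟩
  -- upper bound on the weight of the bad set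
  have hBad : ∫ ζ, Set.indicator {ζ | m + θ ≤ S ζ} (fun _ => (1 : ℝ)) ζ * Real.exp (-β * S ζ) ∂π ≤
      Real.exp (-(β * (m + θ))) := by
    have h2 : ∫ _ζ, Real.exp (-(β * (m + θ))) ∂π = Real.exp (-(β * (m + θ))) := by
      rw [integral_const, smul_eq_mul]; simp [hπ]
    rw [← h2]
    refine integral_mono ?_ (integrable_const _) fun ζ => ?_
    · exact integrable_of_bound (((measurable_const.indicator hBm)).mul hexpm).aestronglyMeasurable
        (C := Real.exp (-β * m)) fun ζ => by
          rw [abs_mul]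
          by_cases hζ : ζ ∈ {ζ : ↥Λ → G | m + θ ≤ S ζ}
          · rw [Set.indicator_of_mem hζ, abs_one, one_mul]; exact hexpb ζ
          · rw [Set.indicator_of_notMem hζ, abs_zero, zero_mul]; exact (Real.exp_pos _).le
    · by_cases hζ : ζ ∈ {ζ : ↥Λ → G | m + θ ≤ S ζ}
      · rw [Set.indicator_of_mem hζ, one_mul, Real.exp_le_exp]
        have hζ' : m + θ ≤ S ζ := hζ
        have := mul_le_mul_of_nonneg_left hζ' hβ
        linarith
      · rw [Set.indicator_of_notMem hζ, zero_mul]; exact (Real.exp_pos _).le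
  -- combine
  have hkey : Real.exp (-(β * (m + θ))) ≤
      Real.exp (-(β * (θ / 2))) / (π O).toReal * ∫ ζ, Real.exp (-β * S ζ) ∂π := by
    have h3 : Real.exp (-(β * (m + θ))) = Real.exp (-(β * (θ / 2))) / (π O).toReal *
        (Real.exp (-(β * (m + θ / 2))) * (π O).toReal) := by
      field_simp
      rw [← Real.exp_add]; ring_nf
    rw [h3]
    exact mul_le_mul_of_nonneg_left hZlow (div_nonneg (Real.exp_pos _).le hp.le)
  exact hBad.trans hkey

/-- **Laplace upper bound for kernel-type ratios.**  If a bounded measurable `F` (read through a measurable map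
`gl : G^Λ → LGConfig`) is `≤ a` wherever `S < m + θ`, then
`(∫ F∘gl · e^{-βS}) / (∫ e^{-βS}) ≤ a + (C_F + |a|) e^{-βθ/2} / p` for all `β ≥ 0`. [folklore] -/
theorem laplace_upper {S : (↥Λ → G) → ℝ} (hS : Continuous S) {m θ : ℝ}
    (hm : ∀ ζ, m ≤ S ζ) (hnear : ∃ ζ, S ζ < m + θ / 2)
    {Φ : (↥Λ → G) → ℝ} (hΦm : Measurable Φ) {CF : ℝ} (hΦb : ∀ ζ, |Φ ζ| ≤ CF) {a : ℝ}
    (hgood : ∀ ζ, S ζ < m + θ → Φ ζ ≤ a) :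
    ∃ p : ℝ, 0 < p ∧ ∀ β : ℝ, 0 ≤ β →
      (∫ ζ, Φ ζ * Real.exp (-β * S ζ) ∂(Measure.pi fun _ : ↥Λ => haarProbability G)) /
          (∫ ζ, Real.exp (-β * S ζ) ∂(Measure.pi fun _ : ↥Λ => haarProbability G)) ≤
        a + (CF + |a|) * (Real.exp (-(β * (θ / 2))) / p) := by
  obtain ⟨p, hp, hL⟩ := laplace_ratio Λ hS hm hnear
  refine ⟨p, hp, fun β hβ => ?_⟩
  obtain ⟨hZ, hB⟩ := hL β hβ
  set π : Measure (↥Λ → G) := Measure.pi fun _ : ↥Λ => haarProbability G with hπ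
  set Bad : Set (↥Λ → G) := {ζ | m + θ ≤ S ζ} with hBad
  have hBm : MeasurableSet Bad := measurableSet_le measurable_const hS.measurable
  have hexpm : Measurable fun ζ : ↥Λ → G => Real.exp (-β * S ζ) :=
    (Real.continuous_exp.comp (continuous_const.mul hS)).measurable
  have hexpb : ∀ ζ, |Real.exp (-β * S ζ)| ≤ Real.exp (-β * m) := fun ζ => by
    rw [abs_of_pos (Real.exp_pos _), Real.exp_le_exp]
    have := mul_le_mul_of_nonneg_left (hm ζ) hβ
    linarith
  have hint : Integrable (fun ζ => Real.exp (-β * S ζ)) π :=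
    integrable_of_bound hexpm.aestronglyMeasurable hexpb
  have hK : 0 ≤ CF + |a| := add_nonneg ((abs_nonneg _).trans (hΦb (Classical.arbitrary (↥Λ → G)))) (abs_nonneg _)
  -- pointwise: Φ e^{-βS} ≤ a e^{-βS} + (CF + |a|) 1_Bad e^{-βS}
  have hpt : ∀ ζ, Φ ζ * Real.exp (-β * S ζ) ≤
      a * Real.exp (-β * S ζ) + (CF + |a|) * (Bad.indicator (fun _ => (1 : ℝ)) ζ * Real.exp (-β * S ζ)) := by
    intro ζ
    have he : 0 < Real.exp (-β * S ζ) := Real.exp_pos _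
    by_cases hζ : ζ ∈ Bad
    · rw [Set.indicator_of_mem hζ, one_mul, ← add_mul]
      refine mul_le_mul_of_nonneg_right ?_ he.le
      have h1 : Φ ζ ≤ CF := (le_abs_self _).trans (hΦb ζ)
      have h2 : -|a| ≤ a := neg_abs_le a
      linarith
    · rw [Set.indicator_of_notMem hζ, zero_mul, mul_zero, add_zero]
      have hζ' : S ζ < m + θ := not_le.1 hζ
      exact mul_le_mul_of_nonneg_right (hgood ζ hζ') he.le
  have hi1 : Integrable (fun ζ => Φ ζ * Real.exp (-β * S ζ)) π :=
    integrable_of_bound (hΦm.mul hexpm).aestronglyMeasurable (C := CF * Real.exp (-β * m)) fun ζ => by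
      rw [abs_mul]; exact mul_le_mul (hΦb ζ) (hexpb ζ) (abs_nonneg _) ((abs_nonneg _).trans (hΦb ζ))
  have hi3 : Integrable (fun ζ => Bad.indicator (fun _ => (1 : ℝ)) ζ * Real.exp (-β * S ζ)) π :=
    integrable_of_bound ((measurable_const.indicator hBm).mul hexpm).aestronglyMeasurable
      (C := Real.exp (-β * m)) fun ζ => by
        rw [abs_mul]
        by_cases hζ : ζ ∈ Bad
        · rw [Set.indicator_of_mem hζ, abs_one, one_mul]; exact hexpb ζ
        · rw [Set.indicator_of_notMem hζ, abs_zero, zero_mul]; exact (Real.exp_pos _).le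
  have hi2 : Integrable (fun ζ => a * Real.exp (-β * S ζ) +
      (CF + |a|) * (Bad.indicator (fun _ => (1 : ℝ)) ζ * Real.exp (-β * S ζ))) π :=
    (hint.const_mul a).add (hi3.const_mul _)
  have hnum : ∫ ζ, Φ ζ * Real.exp (-β * S ζ) ∂π ≤
      a * ∫ ζ, Real.exp (-β * S ζ) ∂π +
        (CF + |a|) * (Real.exp (-(β * (θ / 2))) / p * ∫ ζ, Real.exp (-β * S ζ) ∂π) := by
    calc ∫ ζ, Φ ζ * Real.exp (-β * S ζ) ∂π
        ≤ ∫ ζ, (a * Real.exp (-β * S ζ) +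
            (CF + |a|) * (Bad.indicator (fun _ => (1 : ℝ)) ζ * Real.exp (-β * S ζ))) ∂π :=
          integral_mono hi1 hi2 hpt
      _ = a * ∫ ζ, Real.exp (-β * S ζ) ∂π +
            (CF + |a|) * ∫ ζ, Bad.indicator (fun _ => (1 : ℝ)) ζ * Real.exp (-β * S ζ) ∂π := by
          rw [integral_add (hint.const_mul a) (hi3.const_mul _), integral_const_mul, integral_const_mul]
      _ ≤ _ := by gcongr
  rw [div_le_iff₀ hZ]
  calc ∫ ζ, Φ ζ * Real.exp (-β * S ζ) ∂π ≤ _ := hnum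
    _ = (a + (CF + |a|) * (Real.exp (-(β * (θ / 2))) / p)) * ∫ ζ, Real.exp (-β * S ζ) ∂π := by ring

end Laplace

/-! ## §2 The Dirichlet problem on a cube: kernel means through the fibre integral -/

section Cube

variable (r : LatticeRep G)

omit [Group G] [TopologicalSpace G] [IsTopologicalGroup G] [CompactSpace G] [MeasurableSpace G] [BorelSpace G] in
/-- A configuration agreeing with `η` off `Λ` is the gluing of its restriction to `Λ` with `η`. [folklore] -/
theorem glueWith_restrict_eq (Λ : Finset (ZdEdge 4)) {U η : LGConfig 4 G} (hU : ∀ e, e ∉ Λ → U e = η e) :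
    glueWith Λ (fun e : ↥Λ => U e) η = U := by
  funext e
  by_cases he : e ∈ Λ
  · rw [glueWith_apply_mem _ _ _ he]
  · rw [glueWith_apply_not_mem _ _ _ he, hU e he]

omit [IsTopologicalGroup G] [CompactSpace G] [MeasurableSpace G] [BorelSpace G] in
/-- The boundary Wilson action is non-negative (unitarity of `r`). [folklore] -/
theorem wilsonBoundaryAction_nonneg (Λ : Finset (ZdEdge 4)) (U : LGConfig 4 G) :
    0 ≤ wilsonBoundaryAction r.ρ Λ U :=
  Finset.sum_nonneg fun _ _ => sub_nonneg.2
    (Literature.Barriers.QuantumFields.re_trace_le_of_mem_unitaryGroup (r.mem_unitary _))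

omit [IsTopologicalGroup G] [CompactSpace G] [MeasurableSpace G] [BorelSpace G] in
/-- The boundary Wilson action vanishes at the trivial configuration. [folklore] -/
theorem wilsonBoundaryAction_one (Λ : Finset (ZdEdge 4)) :
    wilsonBoundaryAction r.ρ Λ (fun _ => (1 : G)) = 0 := by
  unfold wilsonBoundaryAction
  refine Finset.sum_eq_zero fun p _ => ?_
  simp [Literature.MathematicalPhysics.QuantumLattice.plaquetteObs, plaquetteHolonomyZd, Matrix.trace_one]

omit [IsTopologicalGroup G] [CompactSpace G] [BorelSpace G] in
/-- The single-plane field at `x` is the plaquette observable based at `x`. [folklore] -/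
theorem plane_eq_plaquetteObs (q : Fin 4 × Fin 4) (x : Fin 4 → ℤ) (U : LGConfig 4 G) :
    plane G r q x U = Literature.MathematicalPhysics.QuantumLattice.plaquetteObs r.ρ x q.1 q.2 U := by
  unfold plane
  simp only [Literature.MathematicalPhysics.QuantumLattice.plaquetteObs]
  congr 2
  simp only [plaquetteHolonomyZd, Literature.MathematicalPhysics.QuantumLattice.configShift_apply, sub_neg_eq_add,
    zero_add, add_comm (Pi.single _ _) x]

/-- The edge `(x, i)` lies in the centred cube of side `2R+3` around `x`. [folklore] -/
theorem mem_cubeEdges_centred (x : Fin 4 → ℤ) (R : ℕ) (i : Fin 4) :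
    (x, i) ∈ cubeEdges (fun k => x k - (R + 1)) (2 * R + 3) := by
  unfold cubeEdges cubeSites
  simp only [Finset.mem_filter, Finset.mem_product, Finset.mem_univ, and_true, Fintype.mem_piFinset,
    Finset.mem_Ico, Pi.add_apply, Pi.single_apply]
  refine ⟨fun j => ⟨by omega, by push_cast; omega⟩, fun j => ?_⟩
  split_ifs <;> push_cast <;> omega

/-- The centre plaquette `p_q(x)` touches the centred cube of side `2R+3` around `x`. [folklore] -/
theorem centre_mem_plaquettesTouching {q : Fin 4 × Fin 4} (hq : q.1 < q.2) (x : Fin 4 → ℤ) (R : ℕ) :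
    ((x, ⟨(q.1, q.2), hq⟩) : ZdPlaquette 4) ∈ plaquettesTouching (cubeEdges (fun k => x k - (R + 1)) (2 * R + 3)) := by
  rw [mem_plaquettesTouching_iff]
  refine ⟨(x, q.1), Finset.mem_inter.2 ⟨?_, mem_cubeEdges_centred x R q.1⟩⟩
  simp [plaquetteEdges]

omit [IsTopologicalGroup G] [CompactSpace G] [BorelSpace G] in
/-- The centre plaquette defect is dominated by the boundary action of the centred cube. [folklore] -/
theorem centre_defect_le_wilsonBoundaryAction {q : Fin 4 × Fin 4} (hq : q.1 < q.2) (x : Fin 4 → ℤ) (R : ℕ)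
    (U : LGConfig 4 G) :
    (r.N : ℝ) - plane G r q x U ≤ wilsonBoundaryAction r.ρ (cubeEdges (fun k => x k - (R + 1)) (2 * R + 3)) U := by
  have h := Finset.single_le_sum (s := plaquettesTouching (cubeEdges (fun k => x k - (R + 1)) (2 * R + 3)))
    (f := fun p : ZdPlaquette 4 =>
      (r.N : ℝ) - Literature.MathematicalPhysics.QuantumLattice.plaquetteObs r.ρ p.1 p.2.1.1 p.2.1.2 U)
    (fun p _ => sub_nonneg.2
      (Literature.Barriers.QuantumFields.re_trace_le_of_mem_unitaryGroup (r.mem_unitary _)))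
    (centre_mem_plaquettesTouching hq x R)
  rw [plane_eq_plaquetteObs]
  exact h

omit [IsTopologicalGroup G] [CompactSpace G] [BorelSpace G] in
/-- `|plane| ≤ N` (unitarity: the diagonal entries of a unitary matrix have modulus `≤ 1`). [folklore] -/
theorem abs_plane_le_N (q : Fin 4 × Fin 4) (x : Fin 4 → ℤ) (U : LGConfig 4 G) : |plane G r q x U| ≤ r.N := by
  rw [plane_eq_plaquetteObs]
  refine abs_le.2 ⟨?_, Literature.Barriers.QuantumFields.re_trace_le_of_mem_unitaryGroup (r.mem_unitary _)⟩
  have hU := r.mem_unitary (plaquetteHolonomyZd U x q.1 q.2)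
  have h : ∑ _i : Fin r.N, (-1 : ℝ) ≤ ∑ i, ((r.ρ (plaquetteHolonomyZd U x q.1 q.2)) i i).re :=
    Finset.sum_le_sum fun i _ =>
      (abs_le.1 ((Complex.abs_re_le_norm _).trans (entry_norm_bound_of_unitary hU i i))).1
  calc -(r.N : ℝ) = ∑ _i : Fin r.N, (-1 : ℝ) := by simp
    _ ≤ _ := h
    _ = _ := by rw [Literature.MathematicalPhysics.QuantumLattice.plaquetteObs, Matrix.trace]; simp [Complex.re_sum]

end Cube

/-! ## §3 Kernel means at large `β`: upper cap under a bad exterior, lower floor under the trivial one -/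

section Kernel

variable (r : LatticeRep G)

/-- **Upper cap.**  If every `ζ` with `S_η(ζ) < min + θ` has centre field `≤ a`, then for `β ≥ 0` the kernel
mean of the centre field under `η` is at most `a + (N + |a|) e^{-βθ/2}/p_η`. [folklore] -/
theorem kerE_plane_le_of_nearMin (Λ : Finset (ZdEdge 4)) (η : LGConfig 4 G) (q : Fin 4 × Fin 4) (x : Fin 4 → ℤ)
    {θ a : ℝ} (hθ : 0 < θ) {ζ₀ : ↥Λ → G}
    (hmin : ∀ ζ, wilsonBoundaryAction r.ρ Λ (glueWith Λ ζ₀ η) ≤ wilsonBoundaryAction r.ρ Λ (glueWith Λ ζ η))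
    (hgood : ∀ ζ : ↥Λ → G, wilsonBoundaryAction r.ρ Λ (glueWith Λ ζ η) <
      wilsonBoundaryAction r.ρ Λ (glueWith Λ ζ₀ η) + θ → plane G r q x (glueWith Λ ζ η) ≤ a) :
    ∃ p : ℝ, 0 < p ∧ ∀ β : ℝ, 0 ≤ β →
      ∫ U, plane G r q x U ∂(ymSpecification (d := 4) r.ρ β Λ η) ≤
        a + (r.N + |a|) * (Real.exp (-(β * (θ / 2))) / p) := by
  haveI : SecondCountableTopology G :=
    (r.continuous.isClosedEmbedding r.injective).isEmbedding.secondCountableTopology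
  have hgl : Continuous fun ζ : ↥Λ → G => glueWith Λ ζ η :=
    (continuous_glueWith_prod Λ).comp (Continuous.prodMk continuous_const continuous_id)
  have hS : Continuous fun ζ : ↥Λ → G => wilsonBoundaryAction r.ρ Λ (glueWith Λ ζ η) :=
    (continuous_wilsonBoundaryAction r.ρ r.continuous Λ).comp hgl
  have hΦm : Measurable fun ζ : ↥Λ → G => plane G r q x (glueWith Λ ζ η) :=
    ((continuous_plane r q x).comp hgl).measurable
  obtain ⟨p, hp, hL⟩ := laplace_upper Λ hS (m := wilsonBoundaryAction r.ρ Λ (glueWith Λ ζ₀ η)) (θ := θ) hmin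
    ⟨ζ₀, by linarith⟩ hΦm (fun ζ => abs_plane_le_N r q x _) hgood
  refine ⟨p, hp, fun β hβ => ?_⟩
  rw [integral_ymSpecification r.ρ r.continuous β Λ (continuous_plane r q x).measurable η]
  exact hL β hβ

/-- **Lower floor under the trivial exterior.**  For `β ≥ 0` and every `θ > 0`, the kernel mean of the centre
field of the centred cube under the exterior `1` is at least `N − θ − 3N e^{-βθ/2}/p₀`. [folklore] -/
theorem kerE_plane_ge_trivial {q : Fin 4 × Fin 4} (hq : q.1 < q.2) (x : Fin 4 → ℤ) (R : ℕ) {θ : ℝ} (hθ : 0 < θ) :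
    ∃ p : ℝ, 0 < p ∧ ∀ β : ℝ, 0 ≤ β →
      (r.N : ℝ) - θ - (r.N + |(r.N : ℝ) - θ|) * (Real.exp (-(β * (θ / 2))) / p) ≤
        ∫ U, plane G r q x U ∂(ymSpecification (d := 4) r.ρ β
          (cubeEdges (fun k => x k - (R + 1)) (2 * R + 3)) (fun _ => 1)) := by
  haveI : SecondCountableTopology G :=
    (r.continuous.isClosedEmbedding r.injective).isEmbedding.secondCountableTopology
  set Λ := cubeEdges (fun k => x k - (R + 1)) (2 * R + 3) with hΛ
  set η₀ : LGConfig 4 G := fun _ => 1 with hη₀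
  have hgl : Continuous fun ζ : ↥Λ → G => glueWith Λ ζ η₀ :=
    (continuous_glueWith_prod Λ).comp (Continuous.prodMk continuous_const continuous_id)
  have hS : Continuous fun ζ : ↥Λ → G => wilsonBoundaryAction r.ρ Λ (glueWith Λ ζ η₀) :=
    (continuous_wilsonBoundaryAction r.ρ r.continuous Λ).comp hgl
  -- the minimum is `0`, attained at the trivial inner configuration
  have hm : ∀ ζ : ↥Λ → G, 0 ≤ wilsonBoundaryAction r.ρ Λ (glueWith Λ ζ η₀) := fun ζ =>
    wilsonBoundaryAction_nonneg r Λ _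
  have hzero : wilsonBoundaryAction r.ρ Λ (glueWith Λ (fun _ => (1 : G)) η₀) = 0 := by
    have : glueWith Λ (fun _ : ↥Λ => (1 : G)) η₀ = fun _ => 1 := by
      funext e; by_cases he : e ∈ Λ
      · rw [glueWith_apply_mem _ _ _ he]
      · rw [glueWith_apply_not_mem _ _ _ he]
    rw [this, wilsonBoundaryAction_one]
  -- apply the upper cap to `-plane` with `a := -(N - θ)`
  have hΦm : Measurable fun ζ : ↥Λ → G => -plane G r q x (glueWith Λ ζ η₀) :=
    ((continuous_plane r q x).comp hgl).measurable.neg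
  have hgood : ∀ ζ : ↥Λ → G, wilsonBoundaryAction r.ρ Λ (glueWith Λ ζ η₀) < 0 + θ →
      -plane G r q x (glueWith Λ ζ η₀) ≤ -((r.N : ℝ) - θ) := by
    intro ζ hζ
    have := centre_defect_le_wilsonBoundaryAction r hq x R (glueWith Λ ζ η₀)
    rw [← hΛ] at this
    linarith
  obtain ⟨p, hp, hL⟩ := laplace_upper Λ hS (m := 0) (θ := θ) hm ⟨fun _ => 1, by rw [hzero]; linarith⟩ hΦm
    (fun ζ => by rw [abs_neg]; exact abs_plane_le_N r q x _) hgood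
  refine ⟨p, hp, fun β hβ => ?_⟩
  have h1 := hL β hβ
  rw [integral_ymSpecification r.ρ r.continuous β Λ (continuous_plane r q x).measurable η₀]
  -- turn the bound on `∫ (-Φ) e^{-βS} / Z` into a lower bound on `∫ Φ e^{-βS} / Z`
  have hneg : (∫ ζ, -plane G r q x (glueWith Λ ζ η₀) * Real.exp (-β * wilsonBoundaryAction r.ρ Λ (glueWith Λ ζ η₀))
        ∂(Measure.pi fun _ : ↥Λ => haarProbability G)) =
      -∫ ζ, plane G r q x (glueWith Λ ζ η₀) * Real.exp (-β * wilsonBoundaryAction r.ρ Λ (glueWith Λ ζ η₀))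
        ∂(Measure.pi fun _ : ↥Λ => haarProbability G) := by
    rw [← integral_neg]
    refine congrArg _ (funext fun ζ => ?_)
    ring
  rw [hneg, neg_div] at h1
  rw [abs_neg] at h1
  linarith

end Kernel

end Summit.QuantumFields.YangMills.Theorems.SubOnsetCeilings.Negative

end
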